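import Summits.CriticalPhenomena.Ising3D.Control2DL15BoxRTable
import Mathlib.Tactic.NormNum
import HarnessLib

/-!
# RB-2 certificate `j129649_functional_deriv2d_L15_E040_sig1o8_box0.16-0.22.json` (Λ = 15, E₀ = 40): Δ_ε ∉ [4/25, 11/50] at Δ_σ = 1/8 under A2D′ — (R), the large-`S` half, in the kernel
(cell `pub-ising3x`, seat controls-1 gen 18; KERNEL PATH for the 2D γ-certificates, Λ = 15 — CONTROL-ONLY)

HONEST FRAMING: lottery ticket; floor = tightest certified 3D Ising CFT bounds; no exact-solution
claim without a proof. CONTROL-ONLY (`d = 2`, `Δ_σ = 1/8`, the 2D Ising control; axiom set `A2D′`).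

(R) for the table `wtboxR` (`Control2DL15BoxRTable`), kernel data only: the compactified region polynomial `QhatboxR`
(`S₁ = 80`, `d = 15`) is non-negative on `τ ∈ [0,1]`, `v ∈ [0,1]` by the tensor-Bernstein SHAPE tree `cregboxR`
(1 leaves; every Bernstein coefficient computed and decided in the kernel, `Control2DPolyCertAuto2`, in 1 chunks of
≤ 12 leaves re-assembled along the splits), and `S ≤ S₁` by the per-`J` shapes `cregJboxR` of the Table file;
the root fact `cregboxR_n0` and the per-`J` fact `cregJboxR_ok` are turned into hypothesis `hR` by `region_of_kernelCertAuto` INSIDE the assembly file `Control2DL15BoxR` (no standalone `region_boxR` theorem: its statement would coincide, up to the table's name, with the other Λ = 15 boxes' — gate dedup lint, controls-1 g17). No facts, standard axioms only.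
-/

namespace Summit.CriticalPhenomena.Ising3D.Control2D

open Literature.MathematicalPhysics.QuantumFieldTheory.ConformalBootstrap3D

set_option maxHeartbeats 0 in
set_option maxRecDepth 200000 in
/-- Chunk 0 of the large-`S` tree (box `q₁=1, a₁=0; q₂=1, a₂=0`; 1 leaves), decided in the kernel. [folklore] -/
theorem cregboxR_n0 :
    checkAuto₂ QhatboxR 16 1 0 1 1 0 1
    (Shape₂.leaf) = true := by
  decide +kernel

end Summit.CriticalPhenomena.Ising3D.Control2D
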